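import Summits.HodgeConjecture.CorCM.IrreducibleOddWeightsHellySharp
import Summits.HodgeConjecture.CorCM.IrreducibleOddWeightsProductSpanMinimalIndex
import HarnessLib

/-!
# The INDEX bound `|T₀| ≤ [Gal(L/ℚ) : A] + 1` is attained too: inside any Galois octic field containing the dihedral
# surface triple, every abelian subgroup of the Galois group has index `≥ 2` — read off the Hodge groups — and an
# abelian subgroup of index exactly `2` exists, so `|T₀| = 3 = [Gal(L/ℚ) : A] + 1`

COR-CM (cell `pub-hodgecm2`, binder seat `b16` gen 61, count-neutral claim BLOCKS ARE MEMBERS, file H9 — sharpness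
certificate, index form; theorems only, no definition, no named fact, no `sorry`).  NEW as stated, hence under
`Summits/`.  HONEST FRAMING: statements about three explicitly hypothesised quartic CM fields and a hypothesised Galois
number field `L` of degree `8` receiving them (none is constructed here); `HC_CM` is neither used nor asserted.

File H4 (`IrreducibleOddWeightsProductSpanMinimalIndex`): a minimal non-additive family of CM types of subfields of a
Galois number field `L` has at most `[Gal(L/ℚ) : A] + 1` members for every subgroup `A ≤ Gal(L/ℚ)` with pairwise commuting
elements.  File H7 (`IrreducibleOddWeightsHellySharp`): the dihedral surface triple (`K₀` non-Galois quartic CM, `K₁` its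
reflex-class partner, `K₂ ≃ K₀`, separating types) is a minimal non-additive family with THREE members.  Hence:

* **`DihedralReflexTriple.two_le_index_of_comm`** — for every number field `L`, normal over `ℚ`, receiving `K₀, K₁, K₂`,
  EVERY subgroup of `Gal(L/ℚ)` with pairwise commuting elements has index `≥ 2`; in particular
  **`DihedralReflexTriple.not_forall_commute`**: `Gal(L/ℚ)` is NOT abelian — a Galois-theoretic fact recovered from
  Mumford–Tate ranks (`dim Hg(S₁ × S₂ × S₁′) = 4 < 6` while all pairs are multiplicative; under an abelian Galois group
  pairs would decide, H4).
* §2 (pure group theory) **`exists_comm_index_le_two_of_card_eq_eight`** — a group of order `8` has a subgroup with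
  pairwise commuting elements of index `≤ 2` (a cyclic subgroup of order `≥ 4`, or the whole group when every element
  squares to `1`).
* **`DihedralReflexTriple.exists_comm_index_eq_two`** — if moreover `L/ℚ` is Galois of degree `8` (the common Galois
  closure), some abelian `A ≤ Gal(L/ℚ)` has index EXACTLY `2`, and **`DihedralReflexTriple.card_eq_index_succ`**: the
  minimal non-additive triple has `|T₀| = 3 = [Gal(L/ℚ) : A] + 1` — EQUALITY in H4's `card_le_index_succ_of_minimal_nonadditive`,
  as H7 gave equality in gen 59's degree form `|T₀| ≤ dim MT(A_i)`.

## References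

* [MoonenZarhin1999LowDim] B. Moonen, Yu. Zarhin, *Hodge classes on abelian varieties of low dimension*, Math. Ann.
  315 (1999), "Hodge groups of simple abelian surfaces of CM-type"; §3 (3.1), Remark (3.9).
* [Serre1977] J.-P. Serre, *Linear Representations of Finite Groups*, GTM 42 (1977), §3.1 Thm. 9 and Cor.
* [Shimura1998] G. Shimura, *Abelian Varieties with Complex Multiplication and Modular Functions* (1998), §8.1, §8.4
  Example (2).
* [Gordon1999HodgeAVSurvey] B. B. Gordon, *A survey of the Hodge conjecture for abelian varieties*, 7.5–7.7.
-/

set_option autoImplicit false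

noncomputable section

open scoped BigOperators

open NumberField IntermediateField

namespace Summit.HodgeConjecture.CorCM

/-! ### §1 Pure group theory: groups of order `8` -/

/-- **A group of order `8` has a subgroup with pairwise commuting elements of index at most `2`**: if some element has
order `≥ 4`, the cyclic subgroup it generates; otherwise every element squares to `1` and the group is abelian.
[cite: Serre1977, §3.1 (examples) and §5.3] -/
theorem exists_comm_index_le_two_of_card_eq_eight {G : Type*} [Group G] [Finite G] (h8 : Nat.card G = 8) :
    ∃ A : Subgroup G, (∀ a ∈ A, ∀ b ∈ A, a * b = b * a) ∧ A.index ≤ 2 := by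
  classical
  by_cases h : ∃ g : G, 4 ≤ orderOf g
  · obtain ⟨g, hg⟩ := h
    refine ⟨Subgroup.zpowers g, fun a ha b hb => ?_, ?_⟩
    · obtain ⟨m, rfl⟩ := Subgroup.mem_zpowers_iff.1 ha
      obtain ⟨n, rfl⟩ := Subgroup.mem_zpowers_iff.1 hb
      exact ((Commute.refl g).zpow_zpow m n).eq
    · have hmul := (Subgroup.zpowers g).index_mul_card
      rw [Nat.card_zpowers, h8] at hmul
      have h4 : (Subgroup.zpowers g).index * 4 ≤ (Subgroup.zpowers g).index * orderOf g :=
        Nat.mul_le_mul_left _ hg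
      omega
  · push Not at h
    refine ⟨⊤, fun a _ b _ => ?_, by rw [Subgroup.index_top]; norm_num⟩
    -- every element squares to `1`
    have hsq : ∀ x : G, x * x = 1 := by
      intro x
      have hdvd : orderOf x ∣ 8 := h8 ▸ orderOf_dvd_natCard x
      have hpos : 0 < orderOf x := orderOf_pos x
      have hlt := h x
      have h2 : orderOf x ∣ 2 := by
        interval_cases hx : orderOf x
        · exact one_dvd 2
        · exact dvd_rfl
        · exact absurd hdvd (by decide)
      rw [← pow_two, ← orderOf_dvd_iff_pow_eq_one]
      exact h2
    have hinv : ∀ x : G, x⁻¹ = x := fun x => inv_eq_of_mul_eq_one_right (hsq x)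
    calc a * b = (a * b)⁻¹ := (hinv (a * b)).symm
      _ = b⁻¹ * a⁻¹ := mul_inv_rev a b
      _ = b * a := by rw [hinv, hinv]

/-! ### §2 The dihedral surface triple: every abelian subgroup of `Gal(L/ℚ)` has index `≥ 2` -/

namespace DihedralReflexTriple

open Literature.NumberTheory.ComplexMultiplication
open Literature.AlgebraicGeometry.Motives (CMType)
open Literature.AlgebraicGeometry.Pohlmann1968

variable {K : Fin 3 → Type} [∀ j, Field (K j)] [∀ j, NumberField (K j)] [∀ j, IsCMField (K j)]
  {L : Type} [Field L] [NumberField L] [Normal ℚ L]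

/-- **EVERY ABELIAN SUBGROUP OF `Gal(L/ℚ)` HAS INDEX `≥ 2`, READ OFF THE HODGE GROUPS.**  `K₀` non-Galois quartic CM,
`K₁` its reflex-class partner, `K₂ ≃ K₀`, separating types `Φ`; `L` any number field, normal over `ℚ`, receiving
`K₀, K₁, K₂`; `A ≤ Gal(L/ℚ)` with pairwise commuting elements.  Then `2 ≤ [Gal(L/ℚ) : A]`: the triple is a minimal
non-additive family with three members (H7), and such families have at most `[Gal(L/ℚ) : A] + 1` members (H4).
[cite: MoonenZarhin1999LowDim, "Hodge groups of simple abelian surfaces of CM-type" and §3 (3.1)] [cite: Serre1977, §3.1 Cor. to Thm. 9] -/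
theorem two_le_index_of_comm (h4₀ : Module.finrank ℚ (K 0) = 4) (hK₀ : ¬IsGalois ℚ (K 0))
    (h4₁ : Module.finrank ℚ (K 1) = 4) (hK₁ : ¬IsGalois ℚ (K 1))
    (hMK : ∀ (t : K 1 →+* ℂ) (y : K 1), t y ∈ normalClosure ℚ (K 0) ℂ) (hne : IsEmpty (K 1 →+* K 0))
    (e : K 2 ≃+* K 0) (Φ : ∀ j, CMType (K j)) (hsep : CMAlgebra.IsSeparatingFamily Φ) (ι : L →+* ℂ)
    (emb : ∀ j, K j →+* L) (A : Subgroup (L ≃ₐ[ℚ] L)) (hA : ∀ a ∈ A, ∀ b ∈ A, a * b = b * a) : 2 ≤ A.index := by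
  obtain ⟨hnot, hmin, -⟩ := minimal_nonadditive h4₀ hK₀ h4₁ hK₁ hMK hne e Φ hsep
  have h := card_le_index_succ_of_minimal_nonadditive ι emb Φ A hA Finset.univ hnot hmin
  rw [Finset.card_univ, Fintype.card_fin] at h
  omega

/-- **`Gal(L/ℚ)` IS NOT ABELIAN** for any number field `L`, normal over `ℚ`, receiving the dihedral surface triple —
recovered from Mumford–Tate ranks: under an abelian Galois group PAIRS decide `Hg(∏ A_i) = ∏ Hg(A_i)` (gen 59), but here
all pairs are multiplicative and the triple is not. [cite: MoonenZarhin1999LowDim, "Hodge groups of simple abelian surfaces of CM-type"]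
[cite: Shimura1998, §8.4 Example (2)(C)] -/
theorem not_forall_commute (h4₀ : Module.finrank ℚ (K 0) = 4) (hK₀ : ¬IsGalois ℚ (K 0))
    (h4₁ : Module.finrank ℚ (K 1) = 4) (hK₁ : ¬IsGalois ℚ (K 1))
    (hMK : ∀ (t : K 1 →+* ℂ) (y : K 1), t y ∈ normalClosure ℚ (K 0) ℂ) (hne : IsEmpty (K 1 →+* K 0))
    (e : K 2 ≃+* K 0) (Φ : ∀ j, CMType (K j)) (hsep : CMAlgebra.IsSeparatingFamily Φ) (ι : L →+* ℂ)
    (emb : ∀ j, K j →+* L) : ¬ ∀ a b : L ≃ₐ[ℚ] L, a * b = b * a := by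
  intro hG
  have h := two_le_index_of_comm h4₀ hK₀ h4₁ hK₁ hMK hne e Φ hsep ι emb ⊤ fun a _ b _ => hG a b
  rw [Subgroup.index_top] at h
  omega

/-! ### §3 Inside the Galois closure: an abelian subgroup of index exactly `2`, and `|T₀| = 3 = [Gal(L/ℚ) : A] + 1` -/

/-- **AN ABELIAN SUBGROUP OF INDEX EXACTLY `2`.**  If `L/ℚ` is Galois of degree `8` (the common Galois closure of the
triple) then some `A ≤ Gal(L/ℚ)` with pairwise commuting elements has `[Gal(L/ℚ) : A] = 2` (`≤ 2` by §1 since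
`|Gal(L/ℚ)| = 8`; `≥ 2` by §2). [cite: Shimura1998, §8.4 Example (2)] [cite: Serre1977, §3.1 and §5.3] -/
theorem exists_comm_index_eq_two [IsGalois ℚ L] (hL : Module.finrank ℚ L = 8)
    (h4₀ : Module.finrank ℚ (K 0) = 4) (hK₀ : ¬IsGalois ℚ (K 0))
    (h4₁ : Module.finrank ℚ (K 1) = 4) (hK₁ : ¬IsGalois ℚ (K 1))
    (hMK : ∀ (t : K 1 →+* ℂ) (y : K 1), t y ∈ normalClosure ℚ (K 0) ℂ) (hne : IsEmpty (K 1 →+* K 0))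
    (e : K 2 ≃+* K 0) (Φ : ∀ j, CMType (K j)) (hsep : CMAlgebra.IsSeparatingFamily Φ) (ι : L →+* ℂ)
    (emb : ∀ j, K j →+* L) :
    ∃ A : Subgroup (L ≃ₐ[ℚ] L), (∀ a ∈ A, ∀ b ∈ A, a * b = b * a) ∧ A.index = 2 := by
  have h8 : Nat.card (L ≃ₐ[ℚ] L) = 8 := by
    rw [IsGalois.card_aut_eq_finrank, hL]
  obtain ⟨A, hA, hle⟩ := exists_comm_index_le_two_of_card_eq_eight h8
  exact ⟨A, hA, le_antisymm hle (two_le_index_of_comm h4₀ hK₀ h4₁ hK₁ hMK hne e Φ hsep ι emb A hA)⟩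

/-- **THE INDEX BOUND IS ATTAINED: `|T₀| = 3 = [Gal(L/ℚ) : A] + 1`.**  Inside the Galois closure `L` (Galois of degree
`8`) of the dihedral surface triple there is an abelian `A ≤ Gal(L/ℚ)` for which the minimal non-additive triple has
exactly `[Gal(L/ℚ) : A] + 1` members — EQUALITY in H4's `card_le_index_succ_of_minimal_nonadditive`, companion of H7's
equality `|T₀| = dim MT(S_j)` in the degree form. [cite: MoonenZarhin1999LowDim, "Hodge groups of simple abelian surfaces of CM-type" and §3 (3.1)]
[cite: Serre1977, §3.1 Cor. to Thm. 9] -/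
theorem card_eq_index_succ [IsGalois ℚ L] (hL : Module.finrank ℚ L = 8)
    (h4₀ : Module.finrank ℚ (K 0) = 4) (hK₀ : ¬IsGalois ℚ (K 0))
    (h4₁ : Module.finrank ℚ (K 1) = 4) (hK₁ : ¬IsGalois ℚ (K 1))
    (hMK : ∀ (t : K 1 →+* ℂ) (y : K 1), t y ∈ normalClosure ℚ (K 0) ℂ) (hne : IsEmpty (K 1 →+* K 0))
    (e : K 2 ≃+* K 0) (Φ : ∀ j, CMType (K j)) (hsep : CMAlgebra.IsSeparatingFamily Φ) (ι : L →+* ℂ)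
    (emb : ∀ j, K j →+* L) :
    ∃ A : Subgroup (L ≃ₐ[ℚ] L), (∀ a ∈ A, ∀ b ∈ A, a * b = b * a) ∧
      (CMAlgebra.cmFamilyRank (K := fun j : ((Finset.univ : Finset (Fin 3)) : Set (Fin 3)) => K j) (fun j => Φ j) +
          (Finset.univ : Finset (Fin 3)).card ≠ (∑ j ∈ (Finset.univ : Finset (Fin 3)), cmTypeRank (Φ j)) + 1 ∧
        (∀ T : Finset (Fin 3), T ⊂ Finset.univ → T.Nonempty →
          CMAlgebra.cmFamilyRank (K := fun j : (T : Set (Fin 3)) => K j) (fun j => Φ j) + T.card =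
            (∑ j ∈ T, cmTypeRank (Φ j)) + 1) ∧
        (Finset.univ : Finset (Fin 3)).card = A.index + 1) := by
  obtain ⟨A, hA, hidx⟩ := exists_comm_index_eq_two hL h4₀ hK₀ h4₁ hK₁ hMK hne e Φ hsep ι emb
  obtain ⟨hnot, hmin, -⟩ := minimal_nonadditive h4₀ hK₀ h4₁ hK₁ hMK hne e Φ hsep
  exact ⟨A, hA, hnot, hmin, by rw [Finset.card_univ, Fintype.card_fin, hidx]⟩

end DihedralReflexTriple

end Summit.HodgeConjecture.CorCM

end
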